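import Literature.MathematicalPhysics.QuantumFieldTheory.Balaban1983to89.T4EtaRate
import Summits.QuantumFields.BalabanUV.T4Continuum.Spine.NE2BalabanDecayRate

/-!
# Route «BalabanUVNodes» (cluster K4 «SpineRates»), Track-A DAG node N15 = NE2 — THE KNIT, PART 3: the node's UNIT CONJUNCT `NE2PlusUnit`
# WITH A NON-INERT BACKGROUND BLOCK, at MODEL level, from the in-edge N16 (NE3's `LocalRate`) by name — ROOT B of the row-NE2 lineage read in
# the node's own typed currency

Cell `pub-ymgap`, seat `pub-ymgap-dag-n15-a` (KNIT-BY-NAME; D-0062; chair R424 venue, R429; YM-PLAN v0.12.15 §2c row N15 «IN n02, n03, n06; N16 (NE3,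
the `hNE3` binder of the model END)»; GAPS v1.0 §C l.47).  `bears_on: R4∕N15`.  Answers the discharge referee's GAP-STATED (i) on PART 1
([DAGREFB-G2-READ-5-N15-P408986]: at the `U ≡ 1` knit carriers «the + block is INERT»): here the background carrier is the type of ALL site-based
bond-transporter towers `Rg` and (3.35) is the lineage's regularity class `RegularTransporters L M (liftR L M Rg) α₀ α₀` — a genuine smallness
condition on a genuine class of backgrounds, so the background quantifier of `NE2PlusUnit` has content.

THE STATEMENT KNIT (`N15unit_rootB_of_N16`).  Fix the block factor `L ≥ 2`, a unit torus `M`, the gauge parameter `a > 0`, the gauge-term weight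
`a′ > 0`, the colour index type `o`, a «distance» `dist` on the unit-lattice sites `idx L M 0 × o`, and `d ≥ 1`.  THE FAMILY (`rootBInstance`): index
`k : ℕ` (the coarse run's number of scales), geometry = the unit-lattice sites `idx L M 0 × o` at scale `k` (`η = L^{−k}`, cube size inert `= 1`),
backgrounds = transporter towers with (3.35) := `RegularTransporters … α₀ α₀` (and (3.36) := the same), identity pairing `k ↦ k+1`.  THE KERNEL
(`rootBKernel`): at background `Rg` and sites `x, y`, the NORM of the colour-matrix entry of the η-difference of the lineage's King-averaged unit-lattice
covariances of Bałaban's typed tier-B operator, `(pertCovC P_B(Rg) 1 (k+1) − pertCovC P_B(Rg) 1 k)(x, y)`, `P_B(Rg) = balabanPert (liftR Rg) (gaugeSlot Rg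
(QuT (siteT Rg)) Q1 a′)` ([B9] (3.26) p. 395 shape, the row owner's ROOT B object).  THE HYPOTHESES (displayed, asserted by nobody): `hNE3` = node
N16's shape `T4EtaRateMin.LocalRate (bgReadings (regClass (liftR Rg))) C L⁻¹` FOR EVERY background in the class of size `η⋆ = etaStar o d a a′` (the
N16 → N15 in-edge, OPEN; NOT PRINTED for Bałaban's minimisers), and `hdec` = a level-UNIFORM entry decay `(B, δ)` of those covariances for every such
background (the printed KIND of input: [B9] Thm 3.4 p. 400 ∕ Thm 3.15 (3.187) p. 432, [King1986] (4.34); for the typed model operator NOT in the tree —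
sub-row Δ3 of the lineage).  THE CONCLUSION: `NE2PlusUnit c35 rootBInstance rootBKernel (fun _ _ => True) (unitDist := dist)` with
`(δ₀, a₀, B₀, θ) = (δ∕2, η⋆, max B⋆ 1, √(L⁻¹))`, `B⋆` the lineage's explicit constant at regularity sizes `(η⋆, η⋆)` — by
`NE2BalabanDecayRate.balaban_final_decayStations_of_regular` (ROOT B in the decay currency, pub-balaban t4-ne2-p1 gen 11) at the physical coupling
`t = 1`, the monotonicity of the regularity class in its sizes (`regularTransporters_mono`), and nothing else.

HONEST SCOPE.  (i) MODEL LEVEL: `P_B` is the lineage's typed model of [B9] (3.26) on the tower `idx L M k × o` (no dictionary B0 to Bałaban's own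
operators on his carriers — the located residue of the row); hence NOT the node at the carriers of record (NODE 00) and NOT a discharge.  (ii) CONDITIONAL
on N16-type input at every regular background, on the explicit threshold `η⋆`, and on `hdec`; NE2 (U1a) is NOT proved; count-neutral.  (iii) UNIT LAYER
ONLY; the operator ∕ site layers with background need the multi-scale carriers.  (iv) The kernel is the NORM of a complex colour-matrix entry (the
abstraction `B9.SiteKernel` is real-valued); rate `√(L⁻¹)` and decay `δ∕2` (halved by the lineage's interpolation `Support/DecayRateInterpolation`);
uniform in `k`, in the background and in the torus `M` (the constant does not mention them).  (v) NOT vacuous: the trivial tower `Rg ≡ 1` is in every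
regularity class (`regularTransporters_one`), so the background block is inhabited at every `α₀ ≥ 0`; the guards `0 < α₀`, `1·α₀ ≤ η⋆` are met by
`α₀ = η⋆ > 0` (`etaStar_pos`).  One finite four-torus programme at fixed ε; nothing about ℝ⁴, infinite volume, OS axioms, a mass gap or the Clay problem.
References (locators only, inherited): [B9] = [Balaban1985BackgroundPropagators] CMP 99 (1985): (3.26) p. 395, (3.35)–(3.36) p. 396, Thm 3.4 p. 400,
Thm 3.15 (3.187) p. 432; [King1986] CMP 102 (1986): p. 664 (identity pairing), (4.34), Lemma 4.5 (4.38) p. 674.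
-/

noncomputable section

open scoped BigOperators ComplexConjugate Matrix Matrix.Norms.L2Operator Kronecker

namespace Summit.QuantumFields.YangMills.Theorems.BalabanUVNodesN15RootB

open Literature.MathematicalPhysics.QuantumFieldTheory.Balaban1983to89
open Literature.MathematicalPhysics.QuantumFieldTheory.Balaban1983to89.T4EtaRate (EtaPairing PairedInstance EtaRateIneqUnit NE2PlusUnit)
open Literature.MathematicalPhysics.QuantumFieldTheory.Balaban1983to89.T4EtaRateMin (LocalRate)
open Literature.MathematicalPhysics.QuantumFieldTheory.Balaban1983to89.B5Prop11Plancherel (Tor fine Cst)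
open Literature.MathematicalPhysics.QuantumFieldTheory.Balaban1983to89.B5G183RateUnitTower (lev)
open Summit.QuantumFields.BalabanUV.T4Continuum
open Summit.QuantumFields.BalabanUV.T4Continuum.BalabanAveragedTowerUnit (idx)
open Summit.QuantumFields.BalabanUV.T4Continuum.BackgroundResolventTower (Cpert)
open Summit.QuantumFields.BalabanUV.T4Continuum.KingPairingPlantedLaw (CJ)
open Summit.QuantumFields.BalabanUV.T4Continuum.GramPerturbationLaw (C2gram)
open Summit.QuantumFields.BalabanUV.T4Continuum.BlockPairingGeometry (tau)
open Summit.QuantumFields.BalabanUV.T4Continuum.NestedContourTransport (theta0)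
open Summit.QuantumFields.BalabanUV.T4Continuum.NE2BalabanLayerSharp (kappaBs C2Bs)
open Summit.QuantumFields.BalabanUV.T4Continuum.NE2BalabanWiring (epsR CdeltaR)
open Summit.QuantumFields.BalabanUV.T4Continuum.NE2BalabanFinal (kappa4F C4F)
open Summit.QuantumFields.BalabanUV.T4Continuum.NE2FromNE3 (bgReadings)
open Summit.QuantumFields.BalabanUV.T4Continuum.NE2ColourPerturbedLayer (pertCovC)
open Summit.QuantumFields.BalabanUV.T4Continuum.RegularBackgroundTower (RegularTransporters regClass betaNE3)
open Summit.QuantumFields.BalabanUV.T4Continuum.GaugeTermScalarData (QuT Q1)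
open Summit.QuantumFields.BalabanUV.T4Continuum.RegularSiteTransporters (siteT)
open Summit.QuantumFields.BalabanUV.T4Continuum.NE2BalabanRoot (balabanPert)
open Summit.QuantumFields.BalabanUV.T4Continuum.NE2BalabanGauge (gaugeSlot liftR)
open Summit.QuantumFields.BalabanUV.T4Continuum.NE2BalabanThreshold (etaStar etaStar_pos)
open Summit.QuantumFields.BalabanUV.T4Continuum.NE2BalabanDecayRate (balaban_final_decayStations_of_regular)
open Summit.QuantumFields.BalabanUV.T4Continuum.DecayRateInterpolation (EntryDecay)

variable {d : ℕ} (L : ℕ) [NeZero L] (M : Fin d → ℕ) [hM : ∀ μ, NeZero (M μ)] (a : ℝ) (ha : 0 < a)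
variable {o : Type} [Fintype o] [DecidableEq o]

/-- THE BACKGROUND TYPE of the knit: site-based bond-transporter towers `Rg : (k : ℕ) → Fin d → (T_{η_k} → M_o(ℂ))` (one transporter per
fine site, direction and level), the data ROOT B of the row-NE2 lineage is typed over. [cite: Balaban1985BackgroundPropagators, (3.35) p.396 (the backgrounds, shape)] -/
abbrev Tower (L : ℕ) (M : Fin d → ℕ) (o : Type) : Type := (k : ℕ) → Fin d → (Tor (fine (lev L k) M) → Matrix o o ℂ)

/-! ## §1 The regularity class is monotone in its sizes and contains the trivial tower -/

omit [NeZero L] hM in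
/-- MONOTONICITY of the lineage's (3.35)-shape class in its two sizes. [cite: Balaban1985BackgroundPropagators, (3.35) p.396 (shape)] [folklore] -/
theorem regularTransporters_mono {R : (k : ℕ) → Fin d → (idx L M k → Matrix o o ℂ)} {α β α' β' : ℝ}
    (h : RegularTransporters L M R α β) (hα : α ≤ α') (hβ : β ≤ β') : RegularTransporters L M R α' β' where
  nonneg := ⟨h.nonneg.1.trans hα, h.nonneg.2.trans hβ⟩
  size := fun k ν i => (h.size k ν i).trans hα
  lipschitz := fun k ν μ i => (h.lipschitz k ν μ i).trans (div_le_div_of_nonneg_right hβ (Nat.cast_nonneg _))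

/-! ## §2 The knit family: unit-lattice sites at scale `k`, transporter-tower backgrounds with the (3.35)-shape class, identity pairing -/

/-- THE GEOMETRY at scale `k`: sites = the unit-lattice points × directions × colour indices `idx L M 0 × o`, all of scale index `k`, `η = L^{−k}`;
[B9]'s cube size inert (`= 1`); arguments ∕ cut-offs inert one-point sorts; the geometry's own `dist` inert (`0` — the unit layer carries its distance
separately). [cite: Balaban1985BackgroundPropagators, (3.41) p.397 (site scale convention, shape)] -/
def rootBGeo (k : ℕ) : B9.Geometry where
  Site := idx L M 0 × o
  scale := fun _ => k
  dist := fun _ _ => 0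
  k := k
  eta := ((L : ℝ) ^ k)⁻¹
  L := L
  M := 1
  Loc := Unit
  suppIn := fun _ _ => True
  suppInT := fun _ _ => True
  supNorm := fun _ => 0
  l2Norm := fun _ => 0
  wNorm := fun _ _ => 0
  holder := fun _ _ => 0
  Cut := Unit
  cutIn := fun _ _ => True
  cutInT := fun _ _ => True
  cutH := fun _ _ => 0
  cutSup := fun _ => 0
  suppInT_of_suppIn := fun _ _ h => h
  cutInT_of_cutIn := fun _ _ h => h

/-- THE BACKGROUND CARRIER WITH CONTENT: configurations = transporter towers; `U ≡ 1` = the trivial tower; (3.35) AND (3.36) at size `α₀` := the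
lineage's class `RegularTransporters L M (liftR L M Rg) α₀ α₀` (size `‖L^k(R − 1)‖ ≤ α₀` and lattice-Lipschitz constant `α₀`); the complex classes
(3.37)–(3.38) inert. [cite: Balaban1985BackgroundPropagators, (3.35)–(3.36) p.396 (shapes)] -/
def rootBBg : B9.Backgrounds where
  Cfg := Tower L M o
  one := fun _ _ _ => 1
  mul := fun R S k ν x => R k ν x * S k ν x
  Reg335 := fun _ α₀ Rg => RegularTransporters L M (liftR L M Rg) α₀ α₀
  Reg336 := fun _ α₀ Rg => RegularTransporters L M (liftR L M Rg) α₀ α₀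
  Cplx337 := fun _ _ _ => True
  Cplx338 := fun _ _ _ => True

/-- THE IDENTITY PAIRING `k ↦ k + 1` (both runs' King-averaged covariances live on the SAME unit lattice `idx L M 0 × o`; backgrounds transported
identically). [cite: King1986, p.664 (identity pairing convention before Prop. 3.8)] -/
def rootBPairing (k : ℕ) : EtaPairing (rootBGeo L M (o := o) k) (rootBGeo L M (o := o) (k + 1)) (rootBBg L M (o := o)) (rootBBg L M (o := o)) where
  n := 1
  k_eq := rfl
  L_eq := rfl
  M_eq := rfl
  eta_eq := by
    have hL : (L : ℝ) ≠ 0 := Nat.cast_ne_zero.mpr (NeZero.ne L)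
    show ((L : ℝ) ^ (k + 1))⁻¹ * (L : ℝ) ^ 1 = ((L : ℝ) ^ k)⁻¹
    rw [pow_one, pow_succ, mul_inv, mul_assoc, inv_mul_cancel₀ hL, mul_one]
  ι := fun y => y
  scale_ι := fun _ => rfl
  dist_ι := fun _ _ => rfl
  τ := fun lam => lam
  suppIn_τ := fun _ _ h => h
  supNorm_τ := fun _ => le_rfl
  avg := fun U => U
  avg_one := rfl

/-- THE KNIT FAMILY over the coarse run's number of scales `k`. [folklore] -/
def rootBInstance (k : ℕ) : PairedInstance where
  gc := rootBGeo L M (o := o) k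
  gf := rootBGeo L M (o := o) (k + 1)
  Bc := rootBBg L M (o := o)
  Bf := rootBBg L M (o := o)
  pair := rootBPairing L M k

/-- THE UNIT-LAYER KERNEL: at background `Rg` and sites `x, y`, the NORM of the colour-matrix entry of the η-difference of the King-averaged
unit-lattice covariances of Bałaban's typed tier-B operator between the runs `k + 1` and `k`, at the physical coupling `t = 1`.
[cite: Balaban1985BackgroundPropagators, (3.26) p.395 and Thm 3.15 (3.187) p.432 (objects, shape); King1986, Lemma 4.5 (4.38) p.674 (shape)] -/
def rootBKernel (a' : ℝ) (k : ℕ) : B9.SiteKernel (rootBInstance L M (o := o) k).gc (rootBInstance L M (o := o) k).Bf :=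
  ⟨fun Rg x y =>
    ‖(pertCovC L M a ha (balabanPert L M a (liftR L M Rg) (gaugeSlot L M Rg (QuT L M o (siteT L M Rg)) (Q1 L M o) a')) 1 (k + 1)
        - pertCovC L M a ha (balabanPert L M a (liftR L M Rg) (gaugeSlot L M Rg (QuT L M o (siteT L M Rg)) (Q1 L M o) a')) 1 k) x y‖⟩

/-- `unitDist :=` the chosen «distance» on the unit-lattice sites (any; the lineage's decay stations are stated for every `dist`). [folklore] -/
def rootBDist (dist : idx L M 0 × o → idx L M 0 × o → ℝ) (k : ℕ) :
    (rootBInstance L M (o := o) k).gc.Site → (rootBInstance L M (o := o) k).gc.Site → ℝ := dist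

omit [NeZero L] hM in
/-- NON-VACUITY OF THE BACKGROUND BLOCK: the trivial tower is in every regularity class of nonnegative sizes. [folklore] -/
theorem regularTransporters_one {α β : ℝ} (hα : 0 ≤ α) (hβ : 0 ≤ β) :
    RegularTransporters L M (liftR L M (fun _ _ _ => (1 : Matrix o o ℂ) : Tower L M o)) α β := by
  refine ⟨⟨hα, hβ⟩, fun k ν i => ?_, fun k ν μ i => ?_⟩
  · have h : liftR L M (fun _ _ _ => (1 : Matrix o o ℂ) : Tower L M o) k ν i = 1 := rfl
    rw [h, sub_self, smul_zero]
    simpa using hα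
  · have h1 : liftR L M (fun _ _ _ => (1 : Matrix o o ℂ) : Tower L M o) k ν i = 1 := rfl
    have h2 : liftR L M (fun _ _ _ => (1 : Matrix o o ℂ) : Tower L M o) k ν (tau (fine (lev L k) M) μ i) = 1 := rfl
    rw [h1, h2, sub_self, smul_zero]
    have : (0 : ℝ) ≤ β / (lev L k : ℕ) := by positivity
    simpa using this

/-- THE LINEAGE'S EXPLICIT TWO-LEVEL CONSTANT OF ROOT B at regularity sizes `(η⋆, η⋆)` and coupling `t = 1` (`NE2BalabanDecayRate` §2, read off
verbatim): uniform in the background, in `k` and in the torus `M`. [folklore] -/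
def Bstar (d L : ℕ) (a a' C B : ℝ) (o : Type) [Fintype o] : ℝ :=
  Real.sqrt (2 * B * (2 *
    Cpert (kappaBs o d a (etaStar o d a a') (etaStar o d a a')
        (a * (epsR o d (etaStar o d a a') * (2 + epsR o d (etaStar o d a a')) * Cst d a)) (kappa4F d a a' (etaStar o d a a') (etaStar o d a a')))
      (2 * d * Cst d a) (CJ d a)
      (C2Bs o d L a (etaStar o d a a') (etaStar o d a a') C
        (a * C2gram (Cst d a) 1 (epsR o d (etaStar o d a a')) (2 * d * Cst d a) (CJ d a) (Cst d a)
          (CdeltaR o d a (etaStar o d a a') (theta0 d (etaStar o d a a') (betaNE3 o C))))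
        (C4F o d L a a' (etaStar o d a a') (etaStar o d a a') C)) 0 1 / (1 - (L : ℝ)⁻¹)))

/-- **ROOT B's TWO-LEVEL DECAY RATE AT SIZES `(η⋆, η⋆)`, `t = 1`, FOR EVERY REGULAR BACKGROUND** — `NE2BalabanDecayRate.balaban_final_decayStations_of_regular`
by name, third conclusion: `‖(pertCovC P_B(Rg) 1 (k+1) − pertCovC P_B(Rg) 1 k)(x,y)‖ ≤ Bstar·(√(L⁻¹))^k·e^{−(δ∕2)dist(x,y)}`.  CONDITIONAL on `hNE3`, `hdec`.
[cite: King1986, Lemma 4.5 (4.38) p.674 (shape)] [folklore] -/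
theorem rootB_twoLevel (hL : 2 ≤ L) (hd : 1 ≤ d) {a' : ℝ} (ha' : 0 < a') {C : ℝ} (hC : 0 ≤ C)
    {dist : idx L M 0 × o → idx L M 0 × o → ℝ} {B δ : ℝ} {Rg : Tower L M o}
    (hreg : RegularTransporters L M (liftR L M Rg) (etaStar o d a a') (etaStar o d a a'))
    (hNE3 : LocalRate (bgReadings L M (regClass L M (liftR L M Rg))) C ((L : ℝ)⁻¹))
    (hdec : ∀ k, EntryDecay dist
      (pertCovC L M a ha (balabanPert L M a (liftR L M Rg) (gaugeSlot L M Rg (QuT L M o (siteT L M Rg)) (Q1 L M o) a')) 1 k) B δ)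
    (k : ℕ) (x y : idx L M 0 × o) :
    ‖(pertCovC L M a ha (balabanPert L M a (liftR L M Rg) (gaugeSlot L M Rg (QuT L M o (siteT L M Rg)) (Q1 L M o) a')) 1 (k + 1)
        - pertCovC L M a ha (balabanPert L M a (liftR L M Rg) (gaugeSlot L M Rg (QuT L M o (siteT L M Rg)) (Q1 L M o) a')) 1 k) x y‖
      ≤ Bstar d L a a' C B o * Real.sqrt ((L : ℝ)⁻¹) ^ k * Real.exp (-(δ / 2 * dist x y)) := by
  have h1 : ‖(1 : ℂ)‖ ≤ 1 := by rw [norm_one]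
  obtain ⟨-, -, h2⟩ := balaban_final_decayStations_of_regular L M a ha hL hd hreg hC hNE3 ha' le_rfl le_rfl le_rfl h1 hdec
  exact h2 k x y

/-! ## §3 THE KNIT: N15's unit conjunct with a contentful background block ⇐ N16-type input ∧ printed-kind decay ∧ the threshold -/

/-- **N15's UNIT CONJUNCT `NE2PlusUnit` ON THE ROOT-B FAMILY ⇐ N16 (NE3's `LocalRate`) AT EVERY REGULAR BACKGROUND ∧ `hdec`** (`L ≥ 2`, `d ≥ 1`,
`a, a′ > 0`, `C ≥ 0`, `B ≥ 0`, `δ > 0`, every `c35`, every `dist`): with `η⋆ = etaStar o d a a′`,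
`NE2PlusUnit c35 (rootBInstance L M) (rootBKernel L M a ha a′) (fun _ _ => True) (rootBDist L M dist)` (`inΛ := True`: no
large-field holes in the single-region model) — constants
`(δ₀, a₀, B₀, θ) = (δ∕2, η⋆, max B⋆ 1, √(L⁻¹))`.  MODEL level; CONDITIONAL on the displayed binders; NOT a discharge (HONEST SCOPE (i)–(v)).
[cite: Balaban1985BackgroundPropagators, Thm 3.15 (3.187) p.432 (quantifier template), (3.26) p.395 and (3.35) p.396 (shapes); King1986, Lemma 4.5 (4.38) p.674 (shape)] [folklore] -/
theorem N15unit_rootB_of_N16 (hL : 2 ≤ L) (hd : 1 ≤ d) {a' : ℝ} (ha' : 0 < a') {C : ℝ} (hC : 0 ≤ C)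
    {dist : idx L M 0 × o → idx L M 0 × o → ℝ} {B δ : ℝ} (hδ : 0 < δ)
    (hNE3 : ∀ Rg : Tower L M o, RegularTransporters L M (liftR L M Rg) (etaStar o d a a') (etaStar o d a a') →
      LocalRate (bgReadings L M (regClass L M (liftR L M Rg))) C ((L : ℝ)⁻¹))
    (hdec : ∀ Rg : Tower L M o, RegularTransporters L M (liftR L M Rg) (etaStar o d a a') (etaStar o d a a') →
      ∀ k, EntryDecay dist
        (pertCovC L M a ha (balabanPert L M a (liftR L M Rg) (gaugeSlot L M Rg (QuT L M o (siteT L M Rg)) (Q1 L M o) a')) 1 k) B δ)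
    (c35 : ℝ) :
    NE2PlusUnit c35 (rootBInstance L M (o := o)) (rootBKernel L M a ha a') (fun _ _ => True) (rootBDist L M dist) := by
  have hη : 0 < etaStar o d a a' := etaStar_pos (o := o) (d := d) a ha.le ha'.le
  have hLr : (0 : ℝ) < L := by exact_mod_cast lt_of_lt_of_le zero_lt_two hL
  have hθ0 : 0 < Real.sqrt ((L : ℝ)⁻¹) := Real.sqrt_pos.mpr (inv_pos.mpr hLr)
  have hθ1 : Real.sqrt ((L : ℝ)⁻¹) < 1 := by
    rw [Real.sqrt_lt' one_pos, one_pow]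
    exact inv_lt_one_of_one_lt₀ (by exact_mod_cast hL)
  refine ⟨δ / 2, etaStar o d a a', max (Bstar d L a a' C B o) 1, Real.sqrt ((L : ℝ)⁻¹), half_pos hδ, hη,
    lt_max_of_lt_right one_pos, hθ0, hθ1, fun k α₀ hα hMa Rg h335 _ x y _ _ => ?_⟩
  have hMa' : α₀ ≤ etaStar o d a a' := by
    have e : (rootBInstance L M (o := o) k).gf.M = 1 := rfl
    rw [e, one_mul] at hMa
    exact hMa
  have hreg : RegularTransporters L M (liftR L M Rg) (etaStar o d a a') (etaStar o d a a') :=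
    regularTransporters_mono L M h335 hMa' hMa'
  have h := rootB_twoLevel L M a ha hL hd ha' hC hreg (hNE3 Rg hreg) (hdec Rg hreg) k x y
  show |‖_‖| ≤ max (Bstar d L a a' C B o) 1 * Real.exp (-(δ / 2 * dist x y)) * Real.sqrt ((L : ℝ)⁻¹) ^ k
  rw [abs_of_nonneg (norm_nonneg _)]
  refine h.trans ?_
  have hE : 0 ≤ Real.exp (-(δ / 2 * dist x y)) := (Real.exp_pos _).le
  have hP : 0 ≤ Real.sqrt ((L : ℝ)⁻¹) ^ k := pow_nonneg hθ0.le k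
  calc Bstar d L a a' C B o * Real.sqrt ((L : ℝ)⁻¹) ^ k * Real.exp (-(δ / 2 * dist x y))
      ≤ max (Bstar d L a a' C B o) 1 * Real.sqrt ((L : ℝ)⁻¹) ^ k * Real.exp (-(δ / 2 * dist x y)) := by
        gcongr; exact le_max_left _ _
    _ = max (Bstar d L a a' C B o) 1 * Real.exp (-(δ / 2 * dist x y)) * Real.sqrt ((L : ℝ)⁻¹) ^ k := by ring

end Summit.QuantumFields.YangMills.Theorems.BalabanUVNodesN15RootB

end
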